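import Summits.BirchSwinnertonDyer.BirchSwinnertonDyer.Theorems.PrintCf2SplitBadTwoCyclicInfResSign
import Literature.NumberTheory.EllipticCurves.Rubin1991.TwoVariableSelmerCoefficientTwist
import Literature.NumberTheory.EllipticCurves.ZpExtensionGaloisTwistPrimaryProofs
import HarnessLib

/-!
# `U_∞/𝒞_∞` f.g. torsion by weak Leopoldt, IV (input (X2) of the frame `[K₀K̃_∞ : K̃_∞] = 2`), file 2: THE COEFFICIENT SWITCH
# `A_θ|_{H′} = A_{θ₁}|_{H′}` over `𝔎_∞ = K̄^{H′}`, `H′ ≤ ker θ`, `θ² = 1`, `θ₁ ≡ 1` — `e_* : H¹(H′, A_θ) ≃ H¹(H′, A_{θ₁})` matches the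
# Selmer conditions and turns `conj_σ` into `θ(σ)·conj_σ`

Cell `bsd-print-cf2`, width seat `bsd-line-cf2c-w3` g11, `--supports` the DECIDING research child
`PrintCf2RubinValueTwo.MainConjClauseAtSplitTwoQuadDA` (stmt-BirchSwinnertonDyer-24721; content stub `stub_unitsQuotient`) as a helper; sequel of
`…LeopoldtEigenSelmerTransfer` (file 1). For a quadratic framed character `θ` and the TRIVIAL framed character `θ₁` of `Γ_K`
(`KellerYin2024.charModule ∅ ·`, both `≃ ℚ_p/ℤ_p` as groups by `charModuleEquiv`), and ANY additive isomorphism `e : A_θ ≃+ A_{θ₁}`: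
* §1 `smul_charModule_eq_self_of_trivial`, `equivariant_of_le_ker` — `Γ_K` acts trivially on `A_{θ₁}`; `e` is `H′`-equivariant for every
  `H′ ≤ ker (unitChar θ)` (the compatible pair of the tree's `subgroupH1Congr`);
  `apply_smul_of_unitChar_eq_one` / `apply_smul_of_unitChar_eq_neg_one` — `e(σ·a) = ±(σ·e a)` according to `θ(σ) = ±1`;
* §2 `congr_conjH1_of_unitChar_eq_one` / `congr_conjH1_of_unitChar_eq_neg_one` — on `H¹(H′, ·)`: `e_*(conj_σ x) = conj_σ (e_* x)`, resp.
  `= −conj_σ (e_* x)` (the tree's `subgroupH1Congr_conjH1_eq_zsmul_const` with `c = ±1`) — so the `θ`-EIGEN classes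
  (`conj_{υ⁻¹} s = θ(υ)·s`, `υ ∈ Gal(K̄/K̃_∞)`) correspond to the INVARIANT classes, and for `θ(γᵢ) = 1` the two conjugations by the
  generator pair correspond on the nose;
* §3 **`mem_datumSelmer_bdpData_iff_congr_mem`** — `c ∈ Sel(H′, A_θ) ↔ e_* c ∈ Sel(H′, A_{θ₁})` for Castella's data `bdpData · p v̄` (strict at
  `v̄`, relaxed elsewhere above `p`) and any `S₀`: Greenberg's «`S_{A_s}(F_∞) = S_A(F_∞) ⊗ κ^s`» (the tree's `mem_unrSelmer₂_iff_congr_mem`,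
  written for `H = Gal(K̄/K̃_∞)`, re-run over an arbitrary normal `H′ ≤ ker θ`: the local conditions are kernels of restrictions to subgroups of
  `H′`, on which the coefficient systems agree, and the sign `±1` does not change membership in a subgroup).
THEOREMS ONLY (no `def`, no named fact, no `sorry`); Theses-free; any number field, any prime. HONEST FRAMING: nothing here closes the crux or a
registered stub; no summit statement is proved by this seat; BSD is not proved by any of this.

References: R. Greenberg, LNM 1716 (1999) §4 pp. 105–107 (`A_s`, `S_{A_s}(F_∞) = S_A(F_∞) ⊗ κ^s`) [GreenbergLNM1716]; J.-P. Serre, *Galois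
Cohomology* I §2.4, §5.3 [SerreGaloisCohomology1997]; K. Rubin, Invent. Math. 103 (1991) §4 (5) p. 36 [Rubin1991]; T. Keller, M. Yin,
arXiv:2402.12781v2 §1.1 [KellerYin2024].
-/

noncomputable section

open scoped Classical

set_option linter.dupNamespace false -- D-0017: `…BirchSwinnertonDyer.BirchSwinnertonDyer…` repeats a namespace by design
set_option autoImplicit false

open NumberField IsDedekindDomain Field
open Literature.NumberTheory.EllipticCurves Literature.NumberTheory.EllipticCurves.GreenbergSelmer
open Literature.NumberTheory.EllipticCurves.GreenbergVatsal2000 Literature.NumberTheory.EllipticCurves.Castella2018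
open Literature.NumberTheory.EllipticCurves.KellerYin2024
open Literature.NumberTheory.GaloisRepresentations
open Summit.BirchSwinnertonDyer.BirchSwinnertonDyer.Theorems.PrintCf2.CyclicInfResChar

namespace Summit.BirchSwinnertonDyer.BirchSwinnertonDyer.Theorems.PrintCf2.EigenSelmerCoeff

variable {K : Type} [Field K] {p : ℕ} [Fact p.Prime]
  (θ θ₁ : FramedGaloisRep K (padicCoeffIntegers (∅ : Set (PadicAlgCl p))) 1)

/-! ## §1. The actions: `±1` on `A_θ`, trivial on `A_{θ₁}`; any additive `e : A_θ ≃ A_{θ₁}` is `ker θ`-equivariant -/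

/-- `unitChar θ₁ ≡ 1` for the trivial framed character (`unitChar = det ∘ θ₁` read in `ℤ_p`).
[cite: KellerYin2024, §1.1 (arXiv:2402.12781v2 TeX L441–449)] -/
theorem unitChar_eq_one_of_trivial (hθ₁ : ∀ σ : absoluteGaloisGroup K, θ₁ σ = 1) (σ : absoluteGaloisGroup K) : unitChar θ₁ σ = 1 := by
  change Units.map _ (Matrix.GeneralLinearGroup.det (θ₁ σ)) = 1
  rw [hθ₁ σ, map_one, map_one]

/-- `Γ_K` acts trivially on `A_{θ₁}` for the trivial character. [cite: KellerYin2024, §1.1 (arXiv:2402.12781v2 TeX L441–449)] -/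
theorem smul_charModule_eq_self_of_trivial (hθ₁ : ∀ σ : absoluteGaloisGroup K, θ₁ σ = 1) (σ : absoluteGaloisGroup K)
    (a : charModule (∅ : Set (PadicAlgCl p)) θ₁) : σ • a = a :=
  CharLocalVanishing.smul_eq_self_of_unitChar_eq_one θ₁ (unitChar_eq_one_of_trivial θ₁ hθ₁ σ) a

/-- **Any additive `e : A_θ ≃ A_{θ₁}` is `H′`-equivariant for `H′ ≤ ker θ`** (both sides act trivially) — the compatible pair of
`subgroupH1Congr H′ e`. [cite: GreenbergLNM1716, §4 p. 107] -/
theorem equivariant_of_le_ker (hθ₁ : ∀ σ : absoluteGaloisGroup K, θ₁ σ = 1) {H' : Subgroup (absoluteGaloisGroup K)}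
    (hH' : H' ≤ (unitChar θ).toMonoidHom.ker)
    (e : charModule (∅ : Set (PadicAlgCl p)) θ ≃+ charModule (∅ : Set (PadicAlgCl p)) θ₁) (x : H')
    (t : charModule (∅ : Set (PadicAlgCl p)) θ) :
    (e : charModule (∅ : Set (PadicAlgCl p)) θ →+ charModule (∅ : Set (PadicAlgCl p)) θ₁) (ContinuousMonoidHom.id H' x • t) =
      x • (e : charModule (∅ : Set (PadicAlgCl p)) θ →+ charModule (∅ : Set (PadicAlgCl p)) θ₁) t := by
  change e ((x : absoluteGaloisGroup K) • t) = (x : absoluteGaloisGroup K) • e t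
  rw [CharLocalVanishing.smul_eq_self_of_unitChar_eq_one θ (hH' x.2) t, smul_charModule_eq_self_of_trivial θ₁ hθ₁]

/-- `e(σ·a) = 1 • (σ·e a)` when `θ(σ) = 1`. [cite: GreenbergLNM1716, §4 p. 107] -/
theorem apply_smul_of_unitChar_eq_one (hθ₁ : ∀ σ : absoluteGaloisGroup K, θ₁ σ = 1)
    (e : charModule (∅ : Set (PadicAlgCl p)) θ ≃+ charModule (∅ : Set (PadicAlgCl p)) θ₁) {σ : absoluteGaloisGroup K}
    (hσ : unitChar θ σ = 1) (t : charModule (∅ : Set (PadicAlgCl p)) θ) : e (σ • t) = (1 : ℤ) • (σ • e t) := by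
  rw [CharLocalVanishing.smul_eq_self_of_unitChar_eq_one θ hσ t, smul_charModule_eq_self_of_trivial θ₁ hθ₁, one_zsmul]

/-- `e(σ·a) = (−1) • (σ·e a)` when `θ(σ) = −1`. [cite: GreenbergLNM1716, §4 p. 107] -/
theorem apply_smul_of_unitChar_eq_neg_one (hθ₁ : ∀ σ : absoluteGaloisGroup K, θ₁ σ = 1)
    (e : charModule (∅ : Set (PadicAlgCl p)) θ ≃+ charModule (∅ : Set (PadicAlgCl p)) θ₁) {σ : absoluteGaloisGroup K}
    (hσ : unitChar θ σ = -1) (t : charModule (∅ : Set (PadicAlgCl p)) θ) : e (σ • t) = (-1 : ℤ) • (σ • e t) := by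
  rw [smul_charModule_eq_neg θ hσ t, smul_charModule_eq_self_of_trivial θ₁ hθ₁, map_neg, neg_one_zsmul]

/-! ## §2. `e_*` and the conjugations: `e_*(conj_σ x) = θ(σ)·conj_σ(e_* x)` -/

section Conj

variable {θ θ₁} (hθ₁ : ∀ σ : absoluteGaloisGroup K, θ₁ σ = 1) (H' : Subgroup (absoluteGaloisGroup K)) [H'.Normal]
  (hH' : H' ≤ (unitChar θ).toMonoidHom.ker)
  (e : charModule (∅ : Set (PadicAlgCl p)) θ ≃+ charModule (∅ : Set (PadicAlgCl p)) θ₁)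

/-- **`e_*(conj_σ x) = conj_σ (e_* x)` when `θ(σ) = 1`** (in particular for the generator pair `γ₁, γ₂` of a sign-normalised `θ`).
[cite: GreenbergLNM1716, §4 p. 107] [cite: SerreGaloisCohomology1997, I §5.3] -/
theorem congr_conjH1_of_unitChar_eq_one {σ : absoluteGaloisGroup K} (hσ : unitChar θ σ = 1)
    (x : subgroupH1 H' (charModule (∅ : Set (PadicAlgCl p)) θ)) :
    subgroupH1Congr H' e (equivariant_of_le_ker θ θ₁ hθ₁ hH' e) (conjH1 H' _ σ x) =
      conjH1 H' _ σ (subgroupH1Congr H' e (equivariant_of_le_ker θ θ₁ hθ₁ hH' e) x) := by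
  rw [subgroupH1Congr_conjH1_eq_zsmul_const H' e _ σ 1 (fun t ↦ apply_smul_of_unitChar_eq_one θ θ₁ hθ₁ e hσ t), one_zsmul]

/-- **`e_*(conj_σ x) = −conj_σ (e_* x)` when `θ(σ) = −1`** (so the `θ`-eigen classes of `H¹(H′, A_θ)` are the invariant classes of
`H¹(H′, A_{θ₁})`). [cite: GreenbergLNM1716, §4 p. 107] [cite: SerreGaloisCohomology1997, I §5.3] -/
theorem congr_conjH1_of_unitChar_eq_neg_one {σ : absoluteGaloisGroup K} (hσ : unitChar θ σ = -1)
    (x : subgroupH1 H' (charModule (∅ : Set (PadicAlgCl p)) θ)) :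
    subgroupH1Congr H' e (equivariant_of_le_ker θ θ₁ hθ₁ hH' e) (conjH1 H' _ σ x) =
      -conjH1 H' _ σ (subgroupH1Congr H' e (equivariant_of_le_ker θ θ₁ hθ₁ hH' e) x) := by
  rw [subgroupH1Congr_conjH1_eq_zsmul_const H' e _ σ (-1) (fun t ↦ apply_smul_of_unitChar_eq_neg_one θ θ₁ hθ₁ e hσ t),
    neg_one_zsmul]

/-- The dichotomy packaged: for `θ² = 1`, `e_*(conj_σ x) = conj_σ (e_* x)` or `= −conj_σ (e_* x)`.
[cite: GreenbergLNM1716, §4 p. 107] -/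
theorem congr_conjH1_eq_or_eq_neg (hθ : ∀ σ : absoluteGaloisGroup K, θ σ ^ 2 = 1) (σ : absoluteGaloisGroup K)
    (x : subgroupH1 H' (charModule (∅ : Set (PadicAlgCl p)) θ)) :
    subgroupH1Congr H' e (equivariant_of_le_ker θ θ₁ hθ₁ hH' e) (conjH1 H' _ σ x) =
        conjH1 H' _ σ (subgroupH1Congr H' e (equivariant_of_le_ker θ θ₁ hθ₁ hH' e) x) ∨
      subgroupH1Congr H' e (equivariant_of_le_ker θ θ₁ hθ₁ hH' e) (conjH1 H' _ σ x) =
        -conjH1 H' _ σ (subgroupH1Congr H' e (equivariant_of_le_ker θ θ₁ hθ₁ hH' e) x) := by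
  rcases unitChar_eq_one_or_eq_neg_one θ hθ σ with h | h
  · exact Or.inl (congr_conjH1_of_unitChar_eq_one hθ₁ H' hH' e h x)
  · exact Or.inr (congr_conjH1_of_unitChar_eq_neg_one hθ₁ H' hH' e h x)

end Conj

/-! ## §3. The Selmer conditions for `bdpData` correspond under `e_*` -/

section Selmer

variable [NumberField K] {θ θ₁} (hθ₁ : ∀ σ : absoluteGaloisGroup K, θ₁ σ = 1)
  (H' : Subgroup (absoluteGaloisGroup K)) [H'.Normal] (hH' : H' ≤ (unitChar θ).toMonoidHom.ker)
  (e : charModule (∅ : Set (PadicAlgCl p)) θ ≃+ charModule (∅ : Set (PadicAlgCl p)) θ₁)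
  (vbar : HeightOneSpectrum (𝓞 K)) (S₀ : Set (HeightOneSpectrum (𝓞 K)))

/-- **`c ∈ Sel^{S₀}(H′, A_θ) ↔ e_* c ∈ Sel^{S₀}(H′, A_{θ₁})`** for Castella's data `bdpData · p v̄` over any normal `H′ ≤ ker θ` (`θ² = 1`,
`θ₁ ≡ 1`, `e` any additive isomorphism): the unramified conditions away from `p` and Greenberg's condition for the strict datum at `v̄` are
kernels of restrictions to `H′ ⊓ I_w`, on which the two coefficient systems agree (`resH1Hom_id_congr_eq_zero_iff`,
`mem_greenbergKer_strictDatum_iff_resOfLe`); they are imposed on every conjugate `conj_σ c`, and `e_*(conj_σ c) = ±conj_σ(e_* c)` (§2) with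
`−y ∈ N ↔ y ∈ N`; the relaxed data impose nothing. Greenberg's «`S_{A_s}(F_∞) = S_A(F_∞) ⊗ κ^s`» — adapted from the tree's
`mem_unrSelmer₂_iff_congr_mem` (`H = Gal(K̄/K̃_∞)`, scalars prime to `p`). [cite: GreenbergLNM1716, §4 p. 107] [cite: GreenbergVatsal2000, §2 pp. 16–17, 20] -/
theorem mem_datumSelmer_bdpData_iff_congr_mem (hθ : ∀ σ : absoluteGaloisGroup K, θ σ ^ 2 = 1)
    (c : subgroupH1 H' (charModule (∅ : Set (PadicAlgCl p)) θ)) :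
    c ∈ datumSelmer H' (charModule (∅ : Set (PadicAlgCl p)) θ) p
        (AcSelmer.bdpData (charModule (∅ : Set (PadicAlgCl p)) θ) p vbar) S₀ ↔
      subgroupH1Congr H' e (equivariant_of_le_ker θ θ₁ hθ₁ hH' e) c ∈
        datumSelmer H' (charModule (∅ : Set (PadicAlgCl p)) θ₁) p
          (AcSelmer.bdpData (charModule (∅ : Set (PadicAlgCl p)) θ₁) p vbar) S₀ := by
  -- adapted from Literature/NumberTheory/EllipticCurves/Rubin1991/TwoVariableSelmerCoefficientTwist.lean (`mem_unrSelmer₂_iff_congr_mem`)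
  set T := charModule (∅ : Set (PadicAlgCl p)) θ with hT
  set M := charModule (∅ : Set (PadicAlgCl p)) θ₁ with hM
  have he := equivariant_of_le_ker θ θ₁ hθ₁ hH' e
  -- the two coefficient systems agree on every restriction kernel
  have hunr : ∀ (w : HeightOneSpectrum (𝓞 K)) (y : subgroupH1 H' T),
      subgroupH1Congr H' e he y ∈ unramifiedKer H' M w ↔ y ∈ unramifiedKer H' T w := fun w y ↦
    resH1Hom_id_congr_eq_zero_iff H' e he (inertiaInToH H' w) (fun _ _ ↦ rfl) (fun _ _ ↦ rfl) y
  have hstr : ∀ (w : HeightOneSpectrum (𝓞 K)) (y : subgroupH1 H' T),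
      subgroupH1Congr H' e he y ∈ (AcSelmer.strictDatum M w).greenbergKer H' ↔
        y ∈ (AcSelmer.strictDatum T w).greenbergKer H' := by
    intro w y
    rw [mem_greenbergKer_strictDatum_iff_resOfLe, mem_greenbergKer_strictDatum_iff_resOfLe, resOfLe, resOfLe]
    exact resH1Hom_id_congr_eq_zero_iff H' e he _ (fun _ _ ↦ rfl) (fun _ _ ↦ rfl) y
  -- `±` does not change membership in a subgroup
  have key : ∀ (σ : absoluteGaloisGroup K) (N : AddSubgroup (subgroupH1 H' M)),
      subgroupH1Congr H' e he (conjH1 H' T σ c) ∈ N ↔ conjH1 H' M σ (subgroupH1Congr H' e he c) ∈ N := by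
    intro σ N
    rcases congr_conjH1_eq_or_eq_neg hθ₁ H' hH' e hθ σ c with h | h
    · rw [h]
    · rw [h, neg_mem_iff]
  have hrelT : ∀ w : HeightOneSpectrum (𝓞 K), (AcSelmer.relaxedDatum T w).greenbergKer H' = ⊤ := fun w ↦
    top_le_iff.mp fun y _ ↦ (AcSelmer.relaxedDatum T w).strictKer_le_greenbergKer H'
      (by rw [AcSelmer.strictKer_relaxedDatum_eq_top]; trivial)
  have hrelM : ∀ w : HeightOneSpectrum (𝓞 K), (AcSelmer.relaxedDatum M w).greenbergKer H' = ⊤ := fun w ↦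
    top_le_iff.mp fun y _ ↦ (AcSelmer.relaxedDatum M w).strictKer_le_greenbergKer H'
      (by rw [AcSelmer.strictKer_relaxedDatum_eq_top]; trivial)
  rw [mem_datumSelmer_iff, mem_datumSelmer_iff, mem_unramifiedOutside_iff, mem_unramifiedOutside_iff]
  refine and_congr (forall₃_congr fun w _ _ ↦ forall_congr' fun σ ↦ ?_) (forall₂_congr fun w hw ↦ forall_congr' fun σ ↦ ?_)
  · rw [← hunr, key]
  · by_cases hwv : w = vbar
    · subst hwv
      rw [AcSelmer.bdpData_self, AcSelmer.bdpData_self, ← hstr, key]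
    · rw [AcSelmer.bdpData_of_ne _ _ hw hwv, AcSelmer.bdpData_of_ne _ _ hw hwv, hrelT, hrelM]
      simp

end Selmer

end Summit.BirchSwinnertonDyer.BirchSwinnertonDyer.Theorems.PrintCf2.EigenSelmerCoeff

end
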